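import Summits.Langlands.Langlands.Theorems.PicardMuOrdinaryMuOrdinaryFamilyRTThorneWeightData
import Summits.Langlands.Langlands.Theorems.PicardMuOrdinaryMuOrdinaryFamilyRTThorneReduction
import Summits.Langlands.Langlands.Theorems.PicardMuOrdinaryMuOrdinaryFamilyRTThorneArithmeticPoints
import Summits.Langlands.Langlands.Theorems.PicardMuOrdinaryMuOrdinaryFamilyRTThorneCompanionsReduction
import HarnessLib

/-!
# Crux `MuOrdinaryFamilyRT` (stmt-Langlands-13757), line `thorne-minimal-lift`: the kernel-checked reductions of
# skeleton v5 over the weight-data Defs (Reduction file of `…ThorneWeightData`, p158875)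

Skeleton v5 folds the universal weight-space stub (W) of v4 (`stub_weightSpace`) into the family existential
(`T.stub_minimalFamilyW = T.stub_minimalFamily ∧ HasWeightData`, …ThorneWeightData).  This file (proofs only) re-derives the
composition of the line over the relativised statements:

* § 1 `arithmeticPoints_of_weightDataOver` — the conclusion of G3 `Missing.arithmeticPointsNearPicard` for ONE family with weight
  data over `F'` (adapted verbatim from the landed `stub_arithmeticPoints_of`, …ThorneArithmeticPoints p151521);
* § 2 `stub_companionsW_of : MF1 → MF2 → G1 → T.stub_companionsW` — the companions stub relativised to families with weight data,
  from the wall (Hida theory on the definite `U(3)`), the seed and the auxiliary field ALONE (adapted from `stub_companions_of`,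
  …ThorneCompanionsReduction p149551: the G3 hypothesis is gone);
* § 3 `definiteHostPlusW_of`, `MuOrdinaryFamilyRT_of_plusW`, `MuOrdinaryFamilyRT_of_thorneStubsW` — K1⁺ relativised and the crux BY NAME
  from the six v5 stubs `T.stub_minimalFamilyW`, `T.stub_finiteOverWeights`, `T.stub_companionsW`, `T.stub_thorneLift`,
  `T.stub_remainderPlus`, `T.stub_facts` (as the landed `definiteHostPlus_of` / `MuOrdinaryFamilyRT_of_plus` /
  `MuOrdinaryFamilyRT_of_thorneStubs`, …ThorneReduction p140646, with `HasWeightData 𝓕` threaded from the family witness to K1⁺).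

Nothing here discharges a debt; `stub_companionsW_of` and `MuOrdinaryFamilyRT_of_thorneStubsW` are registered on the crux item.
-/

set_option linter.dupNamespace false

namespace Summit.Langlands.Langlands.Cruxes.MuOrdinaryFamilyRT.ThorneMinimalLift

open scoped NumberField Polynomial Matrix Classical
open Field IsDedekindDomain Polynomial
open Literature.NumberTheory.GaloisRepresentations Literature.NumberTheory.Automorphic
open Summit.Langlands.Langlands.Cruxes.MuOrdinaryFamilyRT.CharZeroDominance

noncomputable section

variable {f : ℤ[X]} {ι : PadicAlgCl 3 ≃+* ℂ} {e : K →+* ℂ} {S₀ : Finset (HeightOneSpectrum (𝓞 K))}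
  {ρC : FramedGaloisRep K (PadicAlgCl 3) 3}

/-! ## 1. G3 per family from its weight data (adapted from the landed `stub_arithmeticPoints_of`, p151521) -/

/-- **Arithmetic points near the Picard point, for ONE family with weight data over `F'`** (the conclusion of G3
`Missing.arithmeticPointsNearPicard` at `(𝓕, F')`, from `WeightDataOver 𝓕 F'`): `D :=` the `E`-integral weights
carrying gap-`≥ 2` labelled weights and transports as in (W); accumulation is (W); a point over `κ ∈ D` is continuous
and integral (`arithmeticPoints_continuous_integral`), polarized over `F'` (`arithmeticPoints_polarized`) and Borel of
weight `λ_w` at `w ∣ 3` (`isBorelOfWeightAt_pointRep`).  Proof adapted verbatim from `stub_arithmeticPoints_of`. -/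
theorem arithmeticPoints_of_weightDataOver (𝓕 : OrdFamily f ι e S₀ ρC) (hfin : Module.Finite 𝓕.Λ 𝓕.R)
    (F' : Type) [Field F'] [NumberField F'] [Algebra K F'] [IsGalois ℚ F'] (hW : WeightDataOver 𝓕 F') :
    ∃ (D : Set (𝓕.Λ →+* PadicAlgCl 3)) (E : IntermediateField ℚ_[3] (PadicAlgCl 3)),
      FiniteDimensional ℚ_[3] E ∧
      (∀ κ ∈ D, ∀ a : 𝓕.Λ, κ a ∈ E ∧ ‖κ a‖ ≤ 1) ∧
      (∀ M : ℕ, ∃ κ ∈ D, ∀ a : 𝓕.Λ,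
        ‖κ a - 𝓕.j (𝓕.x (algebraMap 𝓕.Λ 𝓕.R a))‖ ≤ ((3 : ℝ)⁻¹) ^ M) ∧
      ∀ y : 𝓕.R →+* PadicAlgCl 3, y.comp (algebraMap 𝓕.Λ 𝓕.R) ∈ D →
        (∀ N : ℕ, ∃ M : ℕ, ∀ r ∈ IsLocalRing.maximalIdeal 𝓕.R ^ M, ‖y r‖ ≤ ((3 : ℝ)⁻¹) ^ N) ∧
        (∀ r : 𝓕.R, ‖y r‖ ≤ 1) ∧
        TracePolarizedHom F' 𝓕.m ((pointRep 𝓕 y).comp (absGaloisRestrict K F').toMonoidHom) ∧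
        ∃ wt : (w : HeightOneSpectrum (𝓞 F')) → LabelledWeight (w.adicCompletion F') (PadicAlgCl 3) 3,
          ∀ w : HeightOneSpectrum (𝓞 F'), ((3 : ℕ) : 𝓞 F') ∈ w.asIdeal →
            (∀ τ (i j : Fin 3), i < j → wt w τ j + 2 ≤ wt w τ i) ∧
            ∀ art : LocalArtinData (w.adicCompletion F'), art.IsCanonical →
              IsBorelOfWeightAt F' w art ((pointRep 𝓕 y).comp (absGaloisRestrict K F').toMonoidHom) (wt w) := by
  obtain ⟨E, hE, hκ⟩ := hW
  refine ⟨{κ | (∀ a : 𝓕.Λ, κ a ∈ E ∧ ‖κ a‖ ≤ 1) ∧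
      ∃ wt : (w : HeightOneSpectrum (𝓞 F')) → LabelledWeight (w.adicCompletion F') (PadicAlgCl 3) 3,
        ∀ w : HeightOneSpectrum (𝓞 F'), ((3 : ℕ) : 𝓞 F') ∈ w.asIdeal →
          (∀ τ (i j : Fin 3), i < j → wt w τ j + 2 ≤ wt w τ i) ∧
          ∃ (v : HeightOneSpectrum (𝓞 K)) (γ : absoluteGaloisGroup K)
            (φ : absoluteGaloisGroup (w.adicCompletion F') → absoluteGaloisGroup (v.adicCompletion K)),
            (3 : 𝓞 K) ∈ v.asIdeal ∧
            (∀ τ : absoluteGaloisGroup (w.adicCompletion F'),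
              absGaloisRestrict K F' (absGaloisRestrict F' (w.adicCompletion F') τ) =
                γ * absGaloisRestrict K (v.adicCompletion K) (φ τ) * γ⁻¹) ∧
            ∀ art : LocalArtinData (w.adicCompletion F'), art.IsCanonical →
              ∃ U : OpenSubgroup (absoluteGaloisGroup (w.adicCompletion F')),
                ∀ τw ∈ WeilGroup.inertia (w.adicCompletion F'),
                  WeilGroup.toAbsGalois (w.adicCompletion F') τw ∈ U →
                    φ (WeilGroup.toAbsGalois (w.adicCompletion F') τw) ∈ absInertia (v.adicCompletion K) ∧
                    ∀ i : Fin 3, κ (𝓕.wt v i (φ (WeilGroup.toAbsGalois (w.adicCompletion F') τw))) =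
                      (ordinaryWeightUnit (wt w) i (art.artin τw) : PadicAlgCl 3)},
    E, hE, fun κ hκD => hκD.1, fun M => ?_, fun y hy => ?_⟩
  · obtain ⟨κ, hint, hclose, hwt⟩ := hκ M
    exact ⟨κ, ⟨hint, hwt⟩, hclose⟩
  · obtain ⟨hint, wt, hwt⟩ := hy
    have hκ1 : ∀ a : 𝓕.Λ, ‖y (algebraMap 𝓕.Λ 𝓕.R a)‖ ≤ 1 := fun a => (hint a).2
    obtain ⟨hcont, hyint⟩ := arithmeticPoints_continuous_integral f ι e S₀ ρC 𝓕 hfin y hκ1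
    refine ⟨hcont, hyint, arithmeticPoints_polarized f ι e S₀ ρC 𝓕 y hyint F', wt, fun w hw =>
      ⟨(hwt w hw).1, fun art hart => ?_⟩⟩
    obtain ⟨v, γ, φ, hv, hγ, hart'⟩ := (hwt w hw).2
    obtain ⟨U, hU⟩ := hart' art hart
    exact isBorelOfWeightAt_pointRep 𝓕 y w hv hγ art (wt w) U hU

/-! ## 2. The companions stub, relativised, from MF1 + MF2 + G1 (adapted from the landed `stub_companions_of`, p149551) -/

/-- **`T.stub_companionsW` from the wall and the seed alone.**  As `stub_companions_of` (…ThorneCompanionsReduction),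
with the Galois side G3 now supplied per family by `arithmeticPoints_of_weightDataOver` from the family's own weight data
(`HasWeightData 𝓕`, instantiated at the auxiliary field of G1). -/
theorem stub_companionsW_of : Missing.hidaOrdinaryCompanions → Missing.ordinaryPolarizedSeed → Missing.auxiliaryCMField → T.stub_companionsW := by
  intro hMF1 hMF2 hG1 f ι e S₀ ρC 𝓕 hgen hin hM hdim hpur hfin hW
  obtain ⟨F', iF, iN, iA, iG, iCM, hdeg, hrange, hunr, hsplit⟩ := hG1 f ι e S₀ ρC 𝓕 hgen hin hM
  have hcpt' : isCompact_glFiniteIntegralLevel 3 F' := isCompact_glFiniteIntegralLevel_holds 3 F'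
  obtain ⟨D, E, hE, hint, hacc, hpts⟩ :=
    arithmeticPoints_of_weightDataOver 𝓕 hfin F' (hW F' hdeg hsplit)
  obtain ⟨S', P₀, r₀, hS', hP₀, hirr, hcompat₀, hunr₀, hpol₀, hpur₀, haux₀, hred₀, hord₀⟩ :=
    hMF2 f ι e S₀ ρC 𝓕 hgen hin hM hpur F' hcpt' hdeg hrange hunr hsplit
  refine ⟨F', iF, iN, iA, iG, hcpt', S', D, E, hdeg, iCM, hrange, hE, hS', hint, hacc, ?_⟩
  intro y hy
  obtain ⟨hcont, hyint, hpolar, wt, hwt⟩ := hpts y hy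
  have hdom : ∀ w : HeightOneSpectrum (𝓞 F'), ((3 : ℕ) : 𝓞 F') ∈ w.asIdeal → (wt w).IsDominant :=
    fun w hw => isDominant_of_gaps (wt w) (hwt w hw).1
  have hwit : ∃ ρ : absoluteGaloisGroup F' →* GL (Fin 3) (PadicAlgCl 3), TracePolarizedHom F' 𝓕.m ρ ∧
      ∀ w : HeightOneSpectrum (𝓞 F'), ((3 : ℕ) : 𝓞 F') ∈ w.asIdeal →
        ∀ art : LocalArtinData (w.adicCompletion F'), art.IsCanonical →
          IsBorelOfWeightAt F' w art ρ (wt w) :=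
    ⟨_, hpolar, fun w hw art hart => (hwt w hw).2 art hart⟩
  obtain ⟨P, r, hP, hcompat, -, hpol, hpurr, ⟨g, hcong⟩, hord⟩ :=
    hMF1 F' ι hcpt' S' 𝓕.m hunr hsplit P₀ r₀ hP₀ hirr hcompat₀ hunr₀ hpol₀ hpur₀ haux₀
      (fun σ i j => (hred₀ σ i j).1) hord₀ wt hdom hwit
  refine ⟨P, r, hP, hcompat, hpol, hpurr, hcont, hyint, ⟨g, fun σ i j => ⟨(hcong σ i j).1, ?_⟩⟩, ?_⟩
  · exact norm_sub_lt_one_chain₃ _ _ _ _ (hcong σ i j).2 (hred₀ σ i j).2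
      (norm_cast_rbar_sub_pointRep_lt_one 𝓕 y hcont (absGaloisRestrict K F' σ) i j)
  · intro w hw art hart
    refine ⟨wt w, (hwt w hw).1, hord w hw art hart, ?_⟩
    obtain ⟨g', U, hup, hdiag⟩ := (hwt w hw).2 art hart
    exact ⟨g', U, hup, hdiag⟩

/-! ## 3. K1⁺ relativised, and the crux from the v5 stubs -/

/-- **K1⁺ for families with weight data** from finiteness, the relativised companions and pointwise lifting (as the landed
`definiteHostPlus_of`, …ThorneReduction, with `HasWeightData 𝓕` threaded to the companions). -/
theorem definiteHostPlusW_of :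
    T.stub_finiteOverWeights → T.stub_companionsW → T.stub_thorneLift → T.stub_definiteHostPlusW := by
  intro hfin hcomp hlift f ι e S₀ ρC 𝓕 hgen hin hM hdim hpur hΛ hW
  have hfin' : Module.Finite 𝓕.Λ 𝓕.R := hfin f ι e S₀ ρC 𝓕 hgen hin hM hdim hpur hΛ
  refine ⟨hfin', ?_⟩
  obtain ⟨F', instF, instNF, instA, instG, hcpt', S', D, E, hdeg, hCM, hrange, hE, hS', hDint, hDacc, hcompanion⟩ :=
    hcomp f ι e S₀ ρC 𝓕 hgen hin hM hdim hpur hfin' hW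
  exact ⟨F', instF, instNF, instA, hcpt', S', D, E, hdeg, hE, hS', hDint, hDacc,
    fun y hy => hlift f ι e S₀ ρC 𝓕 hgen hin hM hpur F' hcpt' S' hdeg hCM hrange hS' y (hcompanion y hy)⟩

/-- **The reduction for v5** (the crux UNFOLDED): as the landed `MuOrdinaryFamilyRT_of_plus` (…ThorneReduction) with the
family stub `T.stub_minimalFamilyW` delivering the weight data that the relativised K1⁺ `T.stub_definiteHostPlusW` consumes. -/
theorem MuOrdinaryFamilyRT_of_plusW : S.stub_picardInput → T.stub_minimalFamilyW → T.stub_definiteHostPlusW →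
    S.stub_accumulation → S.stub_quadraticDescent → S.stub_dictionary → T.stub_remainderPlus →
    ∀ (f : ℤ[X]) (hcpt : isCompact_glFiniteIntegralLevel 3 (CyclotomicField 3 ℚ)),
      f.natDegree = 4 → (f.map (Int.castRingHom ℚ)).Separable →
        12 ∣ Nat.card (f.map (Int.castRingHom ℚ)).Gal → ResidualHyp f hcpt → LimitConcl f hcpt := by
  intro h₁ h₂ h₃ h₄ h₅ h₆ h₇ f hcpt hdeg hsep hgal hres
  have hgen : Generic f := ⟨hdeg, hsep, hgal⟩
  obtain ⟨ι, e, S₀, ρC, hin⟩ := h₁ f hgen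
  by_cases hM : MainClassPlus f S₀ ρC
  swap
  · exact h₇ f hcpt ι e S₀ ρC hgen hin hM hres
  have hS₀ : ∀ v : HeightOneSpectrum (𝓞 K), ((3 : ℕ) : 𝓞 K) ∈ v.asIdeal → v ∈ S₀ := hin.1
  have htr := hin.2.2
  obtain ⟨𝓕, hdim, hpur, hΛ, hW⟩ := h₂ f ι e S₀ ρC hgen hin hM
  obtain ⟨hfin, F', _instF, _instNF, _instA, hcpt', S', D, E, hdegF', hE, hS', hDint, hDacc,
      hclass⟩ := h₃ f ι e S₀ ρC 𝓕 hgen hin hM hdim hpur hΛ hW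
  haveI : Module.Finite 𝓕.Λ 𝓕.R := hfin
  have hinj : Function.Injective (algebraMap 𝓕.Λ 𝓕.R) :=
    algebraMap_injective_of_ringKrullDim_le 𝓕.dim_le hdim
  let xq : 𝓕.R →+* PadicAlgCl 3 := 𝓕.j.comp (𝓕.x : 𝓕.R →+* 𝓕.𝒪)
  have hxq : ∀ r, xq r = 𝓕.j (𝓕.x r) := fun r => rfl
  have hdom : ∃ 𝔮 : Ideal 𝓕.R, 𝔮.IsPrime ∧ Ideal.comap (algebraMap 𝓕.Λ 𝓕.R) 𝔮 = ⊥ ∧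
      ∀ r ∈ 𝔮, xq r = 0 := by
    refine ⟨⊥, Ideal.isPrime_bot, ?_, fun r hr => ?_⟩
    · rw [← RingHom.ker_eq_comap_bot]
      exact (RingHom.injective_iff_ker_eq_bot _).mp hinj
    · rw [Ideal.mem_bot] at hr
      rw [hr, map_zero]
  have hxint : ∀ a : 𝓕.Λ, ‖xq (algebraMap 𝓕.Λ 𝓕.R a)‖ ≤ 1 := fun a => by
    rw [hxq]; exact 𝓕.j_norm_le _
  have hDacc' : ∀ M : ℕ, ∃ κ ∈ D, ∀ a : 𝓕.Λ,
      ‖κ a - xq (algebraMap 𝓕.Λ 𝓕.R a)‖ ≤ ((3 : ℝ)⁻¹) ^ M := by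
    intro M
    obtain ⟨κ, hκ, h⟩ := hDacc M
    exact ⟨κ, hκ, fun a => by rw [hxq]; exact h a⟩
  obtain ⟨S, hdesc⟩ := h₅ F' hdegF' hcpt hcpt' ι S'
  obtain ⟨𝔐, h𝔐max, h𝔐3, hdict⟩ := h₆ ι e
  refine ⟨e, 𝔐, S ∪ S₀, h𝔐max, h𝔐3, fun k => ?_⟩
  obtain ⟨y, hyD, hyx⟩ := h₄ 𝓕.Λ 𝓕.R xq D E hE hdom hxint hDint hDacc' k
  obtain ⟨ρy, hρyT, hρyirr, P', hP'reg, hP'⟩ := hclass y hyD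
  obtain ⟨P, hPreg, hP⟩ := hdesc ρy P' hρyirr hP'reg hP'
  refine ⟨P, hPreg, fun 𝔭 h𝔭 => ?_⟩
  have h𝔭S : 𝔭 ∉ S := fun h => h𝔭 (Finset.mem_union_left _ h)
  have h𝔭S₀ : 𝔭 ∉ S₀ := fun h => h𝔭 (Finset.mem_union_right _ h)
  have h3 : ((3 : ℕ) : 𝓞 K) ∉ 𝔭.asIdeal := fun h => h𝔭S₀ (hS₀ 𝔭 h)
  obtain ⟨⟨α, t₀, hα, ht₀⟩, hcompat⟩ := hP 𝔭 h𝔭S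
  have happrox : ∀ g, ‖FramedRep.trace ρy g - FramedRep.trace ρC g‖ ≤ ((3 : ℝ)⁻¹) ^ k := by
    intro g
    rw [hρyT g, ← 𝓕.x_trace g, ← hxq]
    exact hyx _
  obtain ⟨t, u, ht, hu, hut⟩ :=
    hdict k f ρC ρy 𝔭 α t₀ h3 (htr 𝔭 h𝔭S₀) ((hcompat h3) α hα).2 ht₀ happrox
  exact ⟨α, t, u, hα, ht, hu, hut⟩

/-- **The crux from the v5 stubs** (kernel-checked; the Literature facts feed the landed conditional stubs of
char-zero-dominance exactly as in `MuOrdinaryFamilyRT_of_thorneStubs`). -/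
theorem MuOrdinaryFamilyRT_of_thorneStubsW : T.stub_minimalFamilyW → T.stub_finiteOverWeights → T.stub_companionsW → T.stub_thorneLift → T.stub_remainderPlus → T.stub_facts → Summit.Langlands.Langlands.Theses.PicardMuOrdinary.MuOrdinaryFamilyRT :=
  fun h₁ h₂ h₃ h₄ h₅ h₆ =>
    crux_iff.mpr <|
      MuOrdinaryFamilyRT_of_plusW (stub_picardInput_of h₆.1) h₁ (definiteHostPlusW_of h₂ h₃ h₄) stub_accumulation
        (stub_quadraticDescent_of h₆.2.1 h₆.2.2.1
          Literature.NumberTheory.Automorphic.exists_twist_quadraticSign_holds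
          h₆.2.2.2.1 h₆.2.2.2.2.1 h₆.2.2.2.2.2)
        stub_dictionary h₅

end

end Summit.Langlands.Langlands.Cruxes.MuOrdinaryFamilyRT.ThorneMinimalLift
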